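import Literature.MathematicalPhysics.QuantumFieldTheory.Balaban1983to89.B8Thm4SupportLocal
import Literature.MathematicalPhysics.QuantumFieldTheory.Balaban1983to89.B8Prop5KLevelLetters
import Literature.MathematicalPhysics.QuantumFieldTheory.Balaban1983to89.B8LambdaSpaceKLevel

/-!
# `Balaban1983to89.B8Thm4ExistsModHFP` — [Balaban1985RegularSpaces] THEOREM 4 (p. 88), EXISTENCE CLAUSE AT ALL LEVELS ON THE CONCRETE `ℤᵈ`
# CARRIERS WITH THE LANDAU CONDITION OF RECORD (1.38), MODULO THE PROPOSITION-5 FIXED POINT IN PLAIN CURRENCY AND THE IN-EDGE b9 ONLY —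
# the Theorem-4 driver of record composed with the Prop.-5 socket assembly of `B8Prop5KLevelLetters` §4

statement-level skeleton of published theorems with citation tags; proofs where landed; nothing here is a claim about the
Yang–Mills mass gap

T. Bałaban, *Spaces of regular gauge field configurations on a lattice and gauge fixing conditions*, Commun. Math. Phys. **99**
(1985) 75–102 `[Balaban1985RegularSpaces]` ("B8"), Theorem 4 p. 88 and its proof pp. 88–95, Proposition 5 pp. 93–94; [3] =
[Balaban1985Averaging], [4] = [Balaban1985BackgroundPropagators].  STATUS: published, refereed.

CITATION HEADER (lean-in-tree rule).  Cell `pub-ymgap` (YM Track A, DAG node N05 = [B8], HUMAN RULING D-0062), seat `pub-ymgap-dag-n04-b`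
gen 2; piece №41-a of the owner's cut «hP5 at k levels from letters» (n05-a [DAGN05A-G4-CUT-3], dag-lead [REBALANCE №41]).  WHAT IS
REPRODUCED = the last paragraph of the proof of Theorem 4 (p. 94: «Applying Proposition 5 we get u′ … U₁^{u′⁻¹} satisfies the Landau
condition (1.38) for k + 1 levels … (1.29) for k + 1 levels (Sect. E)») CLOSED IN THE KERNEL over the concrete carriers, with the
Proposition-5 fixed point itself — the solution `λ` of (1.106)/(1.107) on the k-level λ-space, produced by the contraction
(1.103)–(1.105) from the Hölder letters `G′, C, H′` of [4] — left as the ONE displayed hypothesis `HFP` (and its level-0 instance `HFP₀`),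
stated in PLAIN currency: `λ` Hermitian, `λ = 0` off `Ω₀` ((1.109)), the bounds (1.108), the multiplier form of the Landau equation for
the right-hand side of the D*-identity (1.86)–(1.88), and (1.29) for the composite gauge transformation (Sect. E).  Kind «kernel-checked
proof», TWO theorems, no `def`, no `… : Prop` fact.

## WHAT IS CERTIFIED HERE (kernel; axioms `propext` / `Classical.choice` / `Quot.sound`)

**`thm4_exists_all_levels_supp_of_HFP`** — the hypotheses of the driver of record
`B8Thm4SupportLocal.thm4_exists_all_levels_supp_landau138` ((1.33) `h33`, (1.34) `h34`/`hAx`, (1.35) `h135`, (1.66)₀ `h66`, the antitone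
family `Ω`, constraint sites `Λs`, classified constraint bonds `Λb` (`hbox`, `hclass`), the explicit windows at `α₂ = 2Lc⋆ + 8α₄`,
`c⋆ = 5dLB₀(α₀ + α₁)`, `d ≥ 2`, `L ≥ 2`, `η > 0`, the in-edge b9 `H59`) with its two Proposition-5 sockets `hP5base`, `hP5` REPLACED by
the plain-currency fixed-point hypotheses `HFP₀`, `HFP` (served by `B8Prop5KLevelLetters.hP5base_of_HFP` / `hP5_of_HFP`: `v := e^{iλ}` is
unitary (`e^{iX}` unitary for Hermitian `X`), `= 1` off `Ω₀`, obeys (1.108), `U₁^{v⁻¹}` satisfies (1.38) at `m + 1` levels by the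
D*-identity and locality on the bonds «b ∈ Ω₀», the smallness of (1.86)–(1.88) read off (1.108)/(1.36) at level 0): FOR EVERY `m ≤ k`
there is a unitary-valued `u`, `= 1` off `Ω₀`, with (1.29) at `m` levels, whose `W = U′^{u⁻¹}` satisfies THE LANDAU CONDITION OF RECORD
`IsLandau138W L m η Ω₀ (Λs m) U₀ W` (`m ≥ 1`) and `W_b = e^{iηA_b}`, `A_b` Hermitian, `‖A_b‖ ≤ c⋆(Lʲη)⁻¹` on the sides of the plaquettes
touching `Ω_j`, `j ≤ m`.

HONEST SCOPE.  The fixed point (`HFP₀`, `HFP` — Proposition 5's contraction on the k-level λ-space with the letters `G′, C, H′` of [4],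
pin-bound in-edge b9) and the in-edge b9 first/gradient lines (`H59`) remain hypotheses; the uniqueness clause of Theorem 4 is
`B8Thm4UniqueLocal` (n05-a), not this file; the ORDER of the composite in (1.29) is the driver's (`u₁·v`; the (1.78)-chain's `u′·u₁` is
reconciled by `B8Prop5KLevelLetters` §3); nothing here discharges the node N05; count-neutral; `T_η ↦ ℤᵈ`; nothing continuum / mass-gap /
Clay.

**`hFP_of_lamSubK`** — the bridge from the k-level λ-space of `B8LambdaSpaceKLevel` (dag-n19-b, №41-b): a point `s` of
`lamSubK η U₀ L (m+1) E`, `E j` = the sides of the plaquettes touching `Ω_j`, with `‖s‖ ≤ α₄` (print's modulus `max{|λ|, |Dλ|₍₋₁₎}`,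
`B8LambdaSpaceKLevel.norm_le_iff`), `λ = lamOf s` Hermitian and `= 0` off `Ω₀`, the multiplier equation and (1.29) for `u₁·e^{iλ}`, IS the
plain-currency hypothesis `HFP` of `B8Prop5KLevelLetters.hP5_step_of_HFP` at level `m` — (1.108) is the norm ball.
-/

noncomputable section

open NormedSpace

namespace Literature.MathematicalPhysics.QuantumFieldTheory.Balaban1983to89.B8Thm4ExistsModHFP

open MatrixLog B7Prop1Explicit B7Prop2Explicit B7Prop1Local B7Eq92Concrete
open B7Prop3Flat (c3)
open B7Prop4GeneralLevels (linCovIter)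
open B7Eq78Linearization (conjR)
open B8Lemma1NonAbelian (mulCfg)
open B8Ineq132 (InAk covDerivFwd)
open B8Eq119TwistedAxial (InAx Restr129)
open B8Eq182Proof (gAd)
open B8Eq184Proof (gaugeExp cfgExp)
open B8Eq188Proof (frakF3)
open B8Eq146AExpansion (iEta)
open B8Eq140Level (SideTouches)
open B8Eq155JBound (Jcur wsup)
open B8ScaledSupNorm (bondNorm msup)
open B8Thm2LogB (blockTop)
open B8Eq138LandauZd (covDivB covLap QT IsLandau138W)
open B8Prop5KLevelLetters (hP5base_of_HFP hP5_of_HFP)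
open B8LambdaSpaceKLevel (lamSubK lamOf)

-- `Site` alone could resolve to the torus sites of `Setup.lean`; re-export the `ℤ^d` sites of `B7Prop1Explicit`.
export B7Prop1Explicit (Site)

variable {d : ℕ} {𝔹 : Type*} [CStarAlgebra 𝔹] [Nontrivial 𝔹]

omit [Nontrivial 𝔹] in
/-- **The plain-currency fixed-point hypothesis `HFP` from a point of the k-level λ-space** (`B8LambdaSpaceKLevel`, №41-b): for
`s ∈ lamSubK η U₀ L (m+1) E`, `E j = {sides of the plaquettes touching Ω_j}`, with `‖s‖ ≤ α₄`, `λ := lamOf s` Hermitian and `= 0` off `Ω₀`,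
the multiplier form of the Landau equation for `λ` and (1.29) for `u₁·e^{iλ}`, the existential `HFP` of `B8Prop5KLevelLetters.hP5_step_of_HFP`
holds with `lam := lamOf s` — (1.108) at the `m + 1` levels is `‖s‖ ≤ α₄` read through `B8LambdaSpaceKLevel.norm_le_iff`.
[cite: Balaban1985RegularSpaces, (1.102) p.93, (1.106)–(1.108) p.94] -/
theorem hFP_of_lamSubK {η : ℝ} (hη : 0 < η) (L m : ℕ) {U₀ : Site d → Fin d → 𝔹ˣ} (Ω : ℕ → Set (Site d)) (Λs : ℕ → ℕ → Set (Site d))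
    (u₁ : Site d → 𝔹ˣ) (A : Site d → Fin d → 𝔹) {α₄ : ℝ} (hα₄ : 0 ≤ α₄)
    (s : lamSubK η U₀ L (m + 1) (fun j => {b : Site d × Fin d | SideTouches (Ω j) b.1 b.2})) (hs : ‖s‖ ≤ α₄)
    (hsa : ∀ x, IsSelfAdjoint (lamOf s x)) (hoff : ∀ x, x ∉ Ω 0 → lamOf s x = 0)
    (hmult : ∃ μ : ℕ → Site d → 𝔹, ∀ x ∈ Ω 0,
      covLap η U₀ ((Ω 0).indicator fun y => covDivB η U₀ A y + covLap η U₀ (lamOf s) y +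
        ((conjR (gaugeExp (lamOf s) y)⁻¹ (covDivB η U₀ A y) - covDivB η U₀ A y) +
          (gAd (covLap η U₀ (lamOf s) y) (lamOf s y) - covLap η U₀ (lamOf s) y) + ∑ μ, frakF3 η U₀ (lamOf s) A y μ)) x =
        QT L (m + 1) (Λs (m + 1)) U₀ μ x)
    (h129 : Restr129 L (m + 1) (Λs (m + 1)) U₀ (u₁ * gaugeExp (lamOf s))) :
    ∃ lam : Site d → 𝔹, (∀ x, IsSelfAdjoint (lam x)) ∧ (∀ x, x ∉ Ω 0 → lam x = 0) ∧
      (∀ j, j ≤ m + 1 → ∀ b ∈ {b : Site d × Fin d | SideTouches (Ω j) b.1 b.2},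
        ‖lam b.1‖ ≤ α₄ ∧ ((L : ℝ) ^ j * η) * ‖covDerivFwd η U₀ b.2 lam b.1‖ ≤ α₄) ∧
      (∃ μ : ℕ → Site d → 𝔹, ∀ x ∈ Ω 0,
        covLap η U₀ ((Ω 0).indicator fun y => covDivB η U₀ A y + covLap η U₀ lam y +
          ((conjR (gaugeExp lam y)⁻¹ (covDivB η U₀ A y) - covDivB η U₀ A y) +
            (gAd (covLap η U₀ lam y) (lam y) - covLap η U₀ lam y) + ∑ μ, frakF3 η U₀ lam A y μ)) x =
          QT L (m + 1) (Λs (m + 1)) U₀ μ x) ∧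
      Restr129 L (m + 1) (Λs (m + 1)) U₀ (u₁ * gaugeExp lam) := by
  obtain ⟨h₁, h₂⟩ := (B8LambdaSpaceKLevel.norm_le_iff hη.le s hα₄).1 hs
  exact ⟨lamOf s, hsa, hoff, fun j hj b hb => ⟨h₁ b.1, h₂ j hj b hb⟩, hmult, h129⟩

/-- **THEOREM 4, EXISTENCE CLAUSE AT ALL LEVELS WITH THE LANDAU CONDITION OF RECORD (1.38), MODULO THE PROPOSITION-5 FIXED POINT IN PLAIN
CURRENCY (`HFP₀`, `HFP`) AND THE IN-EDGE b9 (`H59`) ONLY**: the driver `B8Thm4SupportLocal.thm4_exists_all_levels_supp_landau138` with its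
sockets `hP5base` / `hP5` served by `B8Prop5KLevelLetters.hP5base_of_HFP` / `hP5_of_HFP` (`c⋆ ≤ Lc⋆ ≤ 1/12` from `L ≥ 1`, `c⋆ ≥ 0`).  See the
module docstring for the full hypothesis list. [cite: Balaban1985RegularSpaces, Thm 4 p.88, Prop. 5 pp.93–94, (1.106)–(1.110) p.94, pp.94–95] -/
theorem thm4_exists_all_levels_supp_of_HFP (hd2 : 2 ≤ d) {η : ℝ} (hη : 0 < η) {L : ℕ} (hL : 2 ≤ L) (k : ℕ)
    {U₀ U' : Site d → Fin d → 𝔹ˣ} (hU₀ : ∀ x κ, U₀ x κ ∈ unitaryUnits 𝔹) (hU' : ∀ x κ, U' x κ ∈ unitaryUnits 𝔹)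
    {α₀ α₁ α₄ B₀ cstar a : ℝ} (hα₀ : 0 < α₀) (hα₁ : 0 < α₁) (hα₄ : 0 ≤ α₄) (hB₀ : 0 ≤ B₀)
    (hc : cstar = 5 * d * L * B₀ * (α₀ + α₁))
    (hs₁ : α₄ ≤ 1 / 84) (hs₂ : L * cstar ≤ 1 / 12) (ha : a ≤ 1 / 4) (ha2 : 2 * a ≤ cstar)
    (hα3 : C0 d * α₀ ≤ 1 / 3) (hα4 : 4 * α₀ ≤ c2' d L)
    (h16 : 16 * (2 * (L * cstar) + 8 * α₄) ≤ 1) (hd5 : 5 * (2 * (L * cstar) + 8 * α₄) * ((d : ℝ) - 1) ≤ 4)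
    (hsmall : Real.exp (4 * (800 * ((d : ℝ) + 1) ^ 2 * ((d : ℝ) + 4)) * α₀)
      * (1 + 8 * (131072 * ((d : ℝ) + 1) ^ 2) * (2 * (L * cstar) + 8 * α₄)) ≤ 2)
    (hc₃ : 2 * (2 * (L * cstar) + 8 * α₄) ≤ c3 d L) (hside : 36 * d * B₀ * (2 * (L * cstar) + 8 * α₄) ≤ 1 / 2)
    (h50 : 50 * d * (2 * (L * cstar) + 8 * α₄) ≤ 1) (hsmall₁ : (d : ℝ) * L * α₁ ≤ 1 / 8)
    {C₂ : ℝ} (hC₂ : 8 * (131072 * ((d : ℝ) + 1) ^ 2) * Real.exp (4 * (800 * ((d : ℝ) + 1) ^ 2 * ((d : ℝ) + 4)) * α₀) ≤ C₂)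
    (h61 : 2 * (2 * (L * cstar) + 8 * α₄) ^ 2 + 20 * d * α₀ * (2 * (L * cstar) + 8 * α₄)
      + 2 * C₂ * (2 * (L * cstar) + 8 * α₄) ^ 2 ≤ α₀ + α₁)
    (Ω : ℕ → Set (Site d)) (hΩ : ∀ j, Ω (j + 1) ⊆ Ω j) (Λs : ℕ → ℕ → Set (Site d)) (Λb : ℕ → ℕ → Set (Site d × Fin d))
    (hbox : ∀ m, m ≤ k → ∀ j, j ≤ m → ∀ c ∈ Λb m j, ∀ x, InBox (loK L j c.1) (bondHiK L j c.1 c.2) x → x ∈ Ω j)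
    (hclass : ∀ m, m ≤ k → ∀ j, j ≤ m → ∀ c ∈ Λb m j,
      (c.1 ∈ Λs m j ∧ c.1 + e c.2 ∈ Λs m j) ∨
      (∃ j', j = j' + 1 ∧ (∀ x, (L : ℤ) • c.1 ≤ x → x ≤ (L : ℤ) • c.1 + blockTop L → x ∈ Λs m j') ∧ c.1 + e c.2 ∈ Λs m j) ∨
      (∃ j', j = j' + 1 ∧ c.1 ∈ Λs m j ∧ (∀ x, (L : ℤ) • (c.1 + e c.2) ≤ x → x ≤ (L : ℤ) • (c.1 + e c.2) + blockTop L → x ∈ Λs m j')))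
    (h33 : InAk L k η α₀ Ω U₀) (h34 : InAk L k η α₀ Ω (mulCfg U' U₀))
    (hAx : ∀ m, m ≤ k → InAx L m (Λs m) U₀ (mulCfg U' U₀))
    (h135 : ∀ j, j ≤ k → ∀ (z : Site d) (μ : Fin d), (∀ x, InBox (loK L j z) (bondHiK L j z μ) x → x ∈ Ω j) →
      ‖(avgIter L (mulCfg U' U₀) j z μ : 𝔹) - (avgIter L U₀ j z μ : 𝔹)‖ ≤ α₁)
    (h66 : ∀ b ∈ {b : Site d × Fin d | SideTouches (Ω 0) b.1 b.2}, ‖((U' b.1 b.2 : 𝔹ˣ) : 𝔹) - 1‖ ≤ a)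
    (HFP₀ : ∀ A : Site d → Fin d → 𝔹,
      (∀ j, j ≤ 0 → ∀ b ∈ {b : Site d × Fin d | SideTouches (Ω j) b.1 b.2},
        U' b.1 b.2 = cfgExp η A b.1 b.2 ∧ IsSelfAdjoint (A b.1 b.2) ∧ ‖A b.1 b.2‖ ≤ cstar * ((L : ℝ) ^ j * η)⁻¹) →
      ∃ lam : Site d → 𝔹, (∀ x, IsSelfAdjoint (lam x)) ∧ (∀ x, x ∉ Ω 0 → lam x = 0) ∧
        (∀ j, j ≤ 1 → ∀ b ∈ {b : Site d × Fin d | SideTouches (Ω j) b.1 b.2},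
          ‖lam b.1‖ ≤ α₄ ∧ ((L : ℝ) ^ j * η) * ‖covDerivFwd η U₀ b.2 lam b.1‖ ≤ α₄) ∧
        (∃ μ : ℕ → Site d → 𝔹, ∀ x ∈ Ω 0,
          covLap η U₀ ((Ω 0).indicator fun y => covDivB η U₀ A y + covLap η U₀ lam y +
            ((conjR (gaugeExp lam y)⁻¹ (covDivB η U₀ A y) - covDivB η U₀ A y) +
              (gAd (covLap η U₀ lam y) (lam y) - covLap η U₀ lam y) + ∑ μ, frakF3 η U₀ lam A y μ)) x =
            QT L 1 (Λs 1) U₀ μ x) ∧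
        Restr129 L 1 (Λs 1) U₀ ((1 : Site d → 𝔹ˣ) * gaugeExp lam))
    (HFP : ∀ m, 1 ≤ m → m < k → ∀ (u₁ : Site d → 𝔹ˣ) (U₁ : Site d → Fin d → 𝔹ˣ) (A : Site d → Fin d → 𝔹),
      (∀ x, u₁ x ∈ unitaryUnits 𝔹) → (∀ x, x ∉ Ω 0 → u₁ x = 1) → mgauge U₀ u₁ U₁ = U' → Restr129 L m (Λs m) U₀ u₁ →
      IsLandau138W L m η (Ω 0) (Λs m) U₀ U₁ →
      (∀ j, j ≤ m → ∀ b ∈ {b : Site d × Fin d | SideTouches (Ω j) b.1 b.2},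
        U₁ b.1 b.2 = cfgExp η A b.1 b.2 ∧ IsSelfAdjoint (A b.1 b.2) ∧ ‖A b.1 b.2‖ ≤ cstar * ((L : ℝ) ^ j * η)⁻¹) →
      ∃ lam : Site d → 𝔹, (∀ x, IsSelfAdjoint (lam x)) ∧ (∀ x, x ∉ Ω 0 → lam x = 0) ∧
        (∀ j, j ≤ m + 1 → ∀ b ∈ {b : Site d × Fin d | SideTouches (Ω j) b.1 b.2},
          ‖lam b.1‖ ≤ α₄ ∧ ((L : ℝ) ^ j * η) * ‖covDerivFwd η U₀ b.2 lam b.1‖ ≤ α₄) ∧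
        (∃ μ : ℕ → Site d → 𝔹, ∀ x ∈ Ω 0,
          covLap η U₀ ((Ω 0).indicator fun y => covDivB η U₀ A y + covLap η U₀ lam y +
            ((conjR (gaugeExp lam y)⁻¹ (covDivB η U₀ A y) - covDivB η U₀ A y) +
              (gAd (covLap η U₀ lam y) (lam y) - covLap η U₀ lam y) + ∑ μ, frakF3 η U₀ lam A y μ)) x =
            QT L (m + 1) (Λs (m + 1)) U₀ μ x) ∧
        Restr129 L (m + 1) (Λs (m + 1)) U₀ (u₁ * gaugeExp lam))
    (H59 : ∀ m, 1 ≤ m → m ≤ k → ∀ (u : Site d → 𝔹ˣ) (W : Site d → Fin d → 𝔹ˣ) (A' : Site d → Fin d → 𝔹),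
      (∀ x, u x ∈ unitaryUnits 𝔹) → mgauge U₀ u W = U' → Restr129 L m (Λs m) U₀ u → IsLandau138W L m η (Ω 0) (Λs m) U₀ W →
      (∀ y τ, IsSelfAdjoint (A' y τ)) →
      (∀ j, j ≤ m → ∀ y τ, SideTouches (Ω j) y τ →
        W y τ = cfgExp η A' y τ ∧ ‖A' y τ‖ ≤ (2 * (L * cstar) + 8 * α₄) * ((L : ℝ) ^ j * η)⁻¹) →
      (∀ y τ, (∀ j, j ≤ m → ¬ SideTouches (Ω j) y τ) → A' y τ = 0) →
      msup L m η (-(1 : ℝ)) (fun j (b : Site d × Fin d) => SideTouches (Ω j) b.1 b.2) (fun b => A' b.1 b.2)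
          ≤ B₀ * (bondNorm L m η (-(3 : ℝ)) Ω (fun x μ => Jcur η U₀ A' μ x)
            + wsup 1 (fun p : {p : ℕ × (Site d × Fin d) // p.1 ≤ m ∧ p.2 ∈ Λb m p.1} =>
                linCovIter L U₀ (iEta η A') p.1.1 p.1.2.1 p.1.2.2)) ∧
        msup L m η (-(2 : ℝ)) (fun j (t : Fin d × Fin d × Site d) => SideTouches (Ω j) t.2.2 t.2.1)
            (fun t => covDerivFwd η U₀ t.1 (fun z => A' z t.2.1) t.2.2)
          ≤ B₀ * (bondNorm L m η (-(3 : ℝ)) Ω (fun x μ => Jcur η U₀ A' μ x)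
            + wsup 1 (fun p : {p : ℕ × (Site d × Fin d) // p.1 ≤ m ∧ p.2 ∈ Λb m p.1} =>
                linCovIter L U₀ (iEta η A') p.1.1 p.1.2.1 p.1.2.2))) :
    ∀ m, m ≤ k → ∃ u : Site d → 𝔹ˣ, (∀ x, u x ∈ unitaryUnits 𝔹) ∧ (∀ x, x ∉ Ω 0 → u x = 1) ∧ Restr129 L m (Λs m) U₀ u ∧
      ∃ W : Site d → Fin d → 𝔹ˣ, mgauge U₀ u W = U' ∧ (1 ≤ m → IsLandau138W L m η (Ω 0) (Λs m) U₀ W) ∧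
        ∃ A : Site d → Fin d → 𝔹, ∀ j, j ≤ m → ∀ b ∈ {b : Site d × Fin d | SideTouches (Ω j) b.1 b.2},
          W b.1 b.2 = cfgExp η A b.1 b.2 ∧ IsSelfAdjoint (A b.1 b.2) ∧ ‖A b.1 b.2‖ ≤ cstar * ((L : ℝ) ^ j * η)⁻¹ := by
  have hL1 : (1 : ℝ) ≤ L := by exact_mod_cast le_trans (by norm_num) hL
  have hcstar : 0 ≤ cstar := by rw [hc]; positivity
  have hcs : cstar ≤ 1 / 12 := le_trans (le_mul_of_one_le_left hcstar hL1) hs₂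
  exact B8Thm4SupportLocal.thm4_exists_all_levels_supp_landau138 hd2 hη hL k hU₀ hU' hα₀ hα₁ hα₄ hB₀ hc hs₁ hs₂ ha ha2 hα3 hα4
    h16 hd5 hsmall hc₃ hside h50 hsmall₁ hC₂ h61 Ω hΩ Λs Λb hbox hclass h33 h34 hAx h135 h66
    (hP5base_of_HFP hd2 hη L hU₀ hU' hs₁ hcs ha ha2 Ω Λs h66 HFP₀) (hP5_of_HFP hd2 hη L k hU₀ hs₁ hcs Ω Λs HFP) H59


#print axioms hFP_of_lamSubK
#print axioms thm4_exists_all_levels_supp_of_HFP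

end Literature.MathematicalPhysics.QuantumFieldTheory.Balaban1983to89.B8Thm4ExistsModHFP

end
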